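import Summits.BirchSwinnertonDyer.BirchSwinnertonDyer.Theses.UniversalToricDescent
import Summits.BirchSwinnertonDyer.BirchSwinnertonDyer.Theorems.UniversalToricDescentToricTransportModThreeStubRatSqueeze
import Summits.BirchSwinnertonDyer.BirchSwinnertonDyer.Theorems.UniversalToricDescentAcDualMuZeroCriterion
import Summits.BirchSwinnertonDyer.BirchSwinnertonDyer.Theorems.UniversalToricDescentCharIdealVacuity
import Literature.NumberTheory.EllipticCurves.LiuZhangZhang2018.PAdicWaldspurgerEllipticCurveAdditiveRamifiedTwisted
import Literature.NumberTheory.EllipticCurves.AnticyclotomicPrimeDecomposition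
import HarnessLib

/-!
# Crux `AdditiveSplitIMCInclusionAtThree` (stmt-BirchSwinnertonDyer-20395) — node `tame_pin_translation`
# (crux-ideate cover g30; UNREGISTERED node, `sorry` only in `stub_*`; concludes the crux BY NAME)

TAME PIN TRANSLATION.  The LEAD comb (24207 `ratwall_thin_comb`) and every central-line road for the μ-half meet the FROZEN PIN
`ℒ_BDP(E/K)(𝟙) ~ (log_ω y_K)²·C`, a `y_K`-dependent, unbounded `3`-adic number (barrier B-g26-3), or the twin's `μ = 0` (= S2).  Move
the pin: take a prime `ℓ ∤ 3N` SPLIT in `K` with `3^a ∣ ℓ − 1` and a ring-class character `ν` of conductor `ℓ` and order `3^a`.  Then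
(i) `ν ≡ 1 (mod π)`, `π = ζ_{3^a} − 1`, so the residual Selmer datum of `E ⊗ ν` over `K_∞^{ac}` IS that of `E` and the number `s` of
`μ`-blocks of `X_(∅,0)` is twist-invariant EXACTLY (Greenberg–Vatsal; defect-free because the two primes above a split `ℓ` are finitely
decomposed in `K_∞^{ac}` — Brink 2007 Thm. 2, tree fact `decomp_not_le_kerSubgroup_of_isAnticyclotomic` — and `H¹(K_{∞,w}, E[3])` is
finite at each of the finitely many `w ∣ ℓ`); (ii) the pin of the `ν`-line is the INTERPOLATED VALUE `ℒ_BDP(E/K)(ν) = (Σ_σ ν(σ) log_ω y_ℓ^σ)²·C_ν`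
(Liu–Zhang–Zhang Thm. 1.5.3 at a finite-order character; tree vocabulary `heegnerCharLogSum ι' ι_K ℓ W ν y`), read off POINTS, far from
the tower, independent of `μ(A)`: since `ν ≡ 1 + π·c (mod π²)` with `c(σ) = j` on `σ = σ_ℓ^j`, `Σ ν(σ) y^σ ≡ Tr y_ℓ + π·D_ℓ y_ℓ (mod π²)`
with `D_ℓ = Σ j σ_ℓ^j` the KOLYVAGIN DERIVATIVE, and `Tr_{K[ℓ]/K} y_ℓ = (a_ℓ − σ_λ − σ_λ̄)·u·y_K`-type norm relations put the trace term in
`π²` once `a_ℓ ≡ 2`, `Frob_ℓ = 1` on `E[3]` (Čebotarev); so `v_π(pin_ν at class level) = 1` iff `log_ω(D_ℓ y_ℓ)` is a `3`-adic unit — a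
Jochnowitz/Kolyvagin-type indivisibility of ONE derived Heegner point (Vatsal 2003 «Σ χ(σ)Q^σ is indivisible by λ»; Bertolini–Darmon 1999;
W. Zhang 2014), INSTRUMENTABLE on `1845.d1`; (iii) the LEAD comb transported to the `ν`-line (Hsieh's `μ(ℒ_ν) = 0` at any level, tree fact
`Hsieh2014.thmB_exists_isHsiehLFunction_coeff_norm_eq_one_unrPeriod_anyLevel`; the rational squeeze verbatim) gives
`char X_(∅,0)(E ⊗ ν) ∣ pin_ν · (unit-μ series) · 3^{k}` at class level with the `3^k` absorbed by RATWALL's squeeze, i.e. `μ_π ≤ 2`, i.e.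
the ONE-BLOCK BOUND `s ≤ 2` for `E` itself — uniformly on the O6 rows, with NO S2, NO twin, NO fine-Selmer input.
SYMP (Nekovář 10.7.18: `s` even, node `symplectic_isotropy_cut`) leaves `s ∈ {0, 2}`; the honest residual leaf is LAST-BLOCK EXCLUSION
`s ≠ 2` (IDEA-NEEDED).  PIN FLOOR (barrier note B-g30-1): any `3`-power-order twist is `≡` the trace mod `π`, so `v_π(pin_ν) ≥ 1` at class
level, `≥ 2` at `L`-level, and evenness absorbs exactly that — tame pins certify `s ≤ 2`, never `s = 0`; the node is a PARTIAL lever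
and says so.

Pieces (D-0171 tags): `stub_ratwall` WEAKER (route crux 24207, LEAD); `stub_tamePinSupply` INSTRUMENTABLE / print-adjacent (Čebotarev +
one derived-point logarithm unit; F-g30-a); `stub_oneBlock_of_tamePin` UNDECIDED (transfer: GV twist-invariance of `s` + LEAD comb on the
`ν`-line + Hsieh any level; carries the integrality instance of the minimal model over `𝒪_{ℂ₃}`, S); `stub_symplecticGrowth` UNDECIDED→ATTACKABLE
(verbatim node `symplectic_isotropy_cut`); `stub_lastBlockExclusion` IDEA-NEEDED (honest leaf: `s ≠ 2`; known suppliers only via `s = 0`: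
24737 twin-μ, FINE of node #25 symplectic-isotropy-cut); `stub_finiteOfBoundedInvariants` ATTACKABLE (S, shared).  Kernel (no `sorry`): one-block + SYMP ⟹ `s ≤ 2 ∧ Even s`;
last-block exclusion ⟹ `s = 0` ⟹ bounded invariants ⟹ EXH ⟹ μ-half on the torsion locus ⟹ (+ RATWALL, g17 road with the datum threaded)
the crux BY NAME.  Shape witnesses: no stub mentions `charIdeal`/`L` except RATWALL (a route crux); `LastBlockExclusionAtThree` forbids ONE
growth rate, it does not assert finiteness.  Disproof.lean: none on file for 20395 (checked g30).  Negatives 15532 / 24881: disjoint vocabulary.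
[cite: GreenbergVatsal2000, §2 Prop. (2.8)] [cite: Brink2007, Thm. 2] [cite: LiuZhangZhang2018, Thm. 1.5.3] [cite: Vatsal2003, §1 (Jochnowitz congruence)]
[cite: BertoliniDarmon1999AJM, §1] [cite: WZhang2014, Thm. 1.1] [cite: Hsieh2014, Thm. B] [cite: Nekovar2006, 10.7.18] [cite: Washington1997, §13.2]
-/

set_option linter.dupNamespace false
set_option autoImplicit false

noncomputable section

open scoped Classical NumberField
open NumberField IsDedekindDomain Field WeierstrassCurve
open Literature.NumberTheory.EllipticCurves Literature.NumberTheory.EllipticCurves.IwasawaAlgebra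
open Literature.NumberTheory.EllipticCurves.ZpExtension Literature.NumberTheory.EllipticCurves.GreenbergSelmer
open Literature.NumberTheory.EllipticCurves.ModularForms (ModularParametrizationData heegnerPointComplexOfConductor)
open Literature.NumberTheory.EllipticCurves.LiuZhangZhang2018 (heegnerCharLogSum)
open Summit.BirchSwinnertonDyer.Rank1Residual.X11b Summit.BirchSwinnertonDyer.Rank1Residual.X11b.AcSelmer
open Summit.BirchSwinnertonDyer.BirchSwinnertonDyer.Theorems.SchneiderFree (BranchInducesPrime)
open Summit.BirchSwinnertonDyer.BirchSwinnertonDyer.Theses.UniversalToricDescent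
  (RationalSplitIMCInclusionAtThree AdditiveSplitIMCInclusionAtThree)
open Summit.BirchSwinnertonDyer.BirchSwinnertonDyer.Cruxes.ToricTransportModThree.RatwallThinComb
  (dvd_of_dvd_prime_pow_mul prime_C_three not_C_three_dvd_of_norm_coeff_eq_one)
open Summit.BirchSwinnertonDyer.BirchSwinnertonDyer.Theorems.UniversalToricDescentAcDualMuZero
  (isTorsion_and_exists_generator_of_finite_pTorsion)
open Summit.BirchSwinnertonDyer.BirchSwinnertonDyer.Theorems.UniversalToricDescentCharIdealVacuity
  (span_le_map_charIdeal_of_not_isTorsion)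

namespace Summit.BirchSwinnertonDyer.BirchSwinnertonDyer.Cruxes.AdditiveSplitIMCInclusionAtThree.TamePinTranslation

/-! ## §0 The μ-half on the torsion locus WITH THE DATUM (the crux's own binders `Dt`, `𝔭`, `ι'` threaded) -/

/-- μ-half ON THE TORSION LOCUS, datum form (UNDECIDED; node #25's `ResidualFiniteOnTorsionLocusAtThree` with the crux's binders
`Dt`, `𝔭`, `𝔭' ≠ 𝔭`, `ι'`, `BranchInducesPrime 3 ι' 𝔭` kept, so that pieces which READ POINTS `3`-adically along `ι'` can feed it):
if `X_(∅,0) = XAc (W.baseChange K) 3 κ 𝔭′ ∅ γ` is `Λ`-torsion then `Sel_(∅,0)(K_∞, E[3^∞])[3]` is finite.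
[cite: GreenbergVatsal2000, §2 Prop. (2.8)] [cite: Washington1997, §13.2] -/
def ResidualFiniteOnTorsionLocusWithDatumAtThree : Prop :=
  ∀ (W : WeierstrassCurve ℚ) [W.IsElliptic] [W.IsGloballyMinimal] (N : ℕ) [NeZero N]
    (K : Type) [Field K] [NumberField K] (Dt : ModularParametrizationData W N),
    Summit.BirchSwinnertonDyer.Rank1Residual.Additive.ClassO6 W 3 → W.HasSurjectiveModNGaloisRep 3 →
    W.analyticRank = 1 → W.conductorNorm ℤ = N →
    IsImaginaryQuadratic K → SatisfiesHeegnerHypothesis N K →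
    ∀ (κ : ZpExtension K 3), κ.IsAnticyclotomic →
    ∀ (γ : absoluteGaloisGroup K) [Fact (κ.IsTopGenerator γ)]
      (𝔭 : HeightOneSpectrum (𝓞 K)), ((3 : ℕ) : 𝓞 K) ∈ 𝔭.asIdeal →
    ∀ (𝔭' : HeightOneSpectrum (𝓞 K)), ((3 : ℕ) : 𝓞 K) ∈ 𝔭'.asIdeal → 𝔭' ≠ 𝔭 →
    ∀ (ι' : PadicAlgCl 3 ≃+* ℂ), BranchInducesPrime 3 ι' 𝔭 →
      Module.IsTorsion (IwasawaAlgebra 3) (XAc (W.baseChange K) 3 κ 𝔭' ∅ γ) →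
      Set.Finite {s : selmerAc (W.baseChange K) 3 κ 𝔭' ∅ | (3 : ℕ) • s = 0}

/-! ## §0′ Verbatim from node `symplectic_isotropy_cut` (#25; copied, not imported — Cruxes/Lines modules are not built on the farm snapshot) -/

/-- `V_n := (Sel_(∅ at 𝔭, 0 at 𝔭′)(K_∞, E[3^∞])[3])^{γ^{3^n}}` — the `3`-torsion classes of Castella's anticyclotomic Selmer group (strict above `𝔭′`,
no condition above the other prime) fixed by `conj_{γ^{3^n}}`, as a set (verbatim #25).  `#V_n = 3^{s·3^n + O(1)}` with `s` the number of `μ`-blocks on the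
torsion locus. [cite: Castella2018, Def. 2.2] [cite: Washington1997, §13.2] -/
def InvSet {K : Type} [Field K] [NumberField K] (W : WeierstrassCurve K) (κ : ZpExtension K 3)
    (𝔭' : HeightOneSpectrum (𝓞 K)) (γ : absoluteGaloisGroup K) (n : ℕ) : Set (selmerAc W 3 κ 𝔭' ∅) :=
  {s | (3 : ℕ) • s = 0 ∧ W.conjH1 3 κ.kerSubgroup (γ ^ 3 ^ n) (s : W.subgroupH1 3 κ.kerSubgroup) = s}

/-- **SYMP — Nekovář's dihedral symplectic structure, conjugate-pair form** (verbatim #25; UNDECIDED→ATTACKABLE, print-adjacent): on the torsion locus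
`(X_(∅,0))_tors ~ M ⊕ M` modulo pseudo-null at every height-one prime INCLUDING `(3)`, so the number `s` of `μ`-summands is EVEN and
`#V^{γ^{3^n}} = 3^{s·3^n + O(1)}` two-sidedly.  Nekovář, Selmer Complexes 0.15.3, 10.7.12, 10.7.18. [cite: Greenberg1989, §1 p. 98] [cite: Washington1997, §13.2] -/
def SymplecticGrowthAtThree : Prop :=
  ∀ (W : WeierstrassCurve ℚ) [W.IsElliptic] [W.IsGloballyMinimal] (N : ℕ) [NeZero N]
    (K : Type) [Field K] [NumberField K],
    Summit.BirchSwinnertonDyer.Rank1Residual.Additive.ClassO6 W 3 → W.HasSurjectiveModNGaloisRep 3 →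
    W.analyticRank = 1 → W.conductorNorm ℤ = N →
    IsImaginaryQuadratic K → SatisfiesHeegnerHypothesis N K →
    ∀ (κ : ZpExtension K 3), κ.IsAnticyclotomic →
    ∀ (γ : absoluteGaloisGroup K) [Fact (κ.IsTopGenerator γ)]
      (𝔭' : HeightOneSpectrum (𝓞 K)), ((3 : ℕ) : 𝓞 K) ∈ 𝔭'.asIdeal →
      Module.IsTorsion (IwasawaAlgebra 3) (XAc (W.baseChange K) 3 κ 𝔭' ∅ γ) →
      ∃ s C : ℕ, Even s ∧ ∀ n : ℕ, (InvSet (W.baseChange K) κ 𝔭' γ n).Finite ∧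
        3 ^ (s * 3 ^ n) ≤ Nat.card (InvSet (W.baseChange K) κ 𝔭' γ n) * 3 ^ C ∧
        Nat.card (InvSet (W.baseChange K) κ 𝔭' γ n) ≤ 3 ^ (s * 3 ^ n + C)

/-- **EXH — exhaustion of a discrete `Γ`-module by invariants** (verbatim #25; ATTACKABLE, S-sized): if `#V^{γ^{3^n}} ≤ 3^C` for all `n` then
`V = Sel_(∅,0)(K_∞, E[3^∞])[3]` is finite. [cite: Greenberg1989, §1 p. 98] -/
def FiniteOfBoundedInvariantsAtThree : Prop :=
  ∀ (K : Type) [Field K] [NumberField K] (W : WeierstrassCurve K) [W.IsElliptic] (κ : ZpExtension K 3)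
    (γ : absoluteGaloisGroup K) [Fact (κ.IsTopGenerator γ)] (𝔭' : HeightOneSpectrum (𝓞 K)),
    (∃ C : ℕ, ∀ n : ℕ, (InvSet W κ 𝔭' γ n).Finite ∧ Nat.card (InvSet W κ 𝔭' γ n) ≤ 3 ^ C) →
      Set.Finite {s : selmerAc W 3 κ 𝔭' ∅ | (3 : ℕ) • s = 0}

/-! ## §1 The pieces (Props) -/

/-- **TAME PIN SUPPLY** (INSTRUMENTABLE, print-adjacent; instrument F-g30-a).  On every O6 / onto / `r_an = 1` row, for the branch
`(𝔭, ι')`: there are an embedding `ι_K : K → ℂ` inducing `𝔭` along `ι'`, a prime `ℓ ∤ 3N` SPLIT in `K`, an exponent `a ≥ 1`, a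
ring-class character `ν` of conductor `ℓ` of order `3^a` (so `3^a ∣ #Gal(K[ℓ]/K)`, automatic from `3^a ∣ ℓ − 1` for `K ≠ ℚ(i), ℚ(√−3)`;
Čebotarev supplies `ℓ` with `Frob_ℓ = 1` on `K(E[3], μ_{3^a})`), and the Heegner point `y_ℓ = φ(x_ℓ) ∈ E(K[ℓ])` of conductor `ℓ`
(`heegnerPointComplexOfConductor`), such that the `ν`-ISOTYPIC HEEGNER LOGARITHM `Σ_σ ν(σ) log_ω(y_ℓ^σ)` (LZZ's `P(φ_H, ν)` up to
`h/2`; tree `heegnerCharLogSum`) has `3`-adic valuation `< 1` — i.e. (mod `π²`, `π = ζ_{3^a} − 1`) the valuation of the KOLYVAGIN-DERIVATIVE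
term `π · log_ω(D_ℓ y_ℓ)` with `log_ω(D_ℓ y_ℓ)` a unit.  Threshold normalisation illustrative (LZZ's `log_ω = ℓ_p(m₀·)/m₀`); what the
transfer consumes is «`v_π(pin_ν) = 1` at class level».  Why it might fail: `log_ω(D_ℓ y_ℓ)` could be a non-unit for every admissible `ℓ`
on some row (a `3`-adic Kolyvagin-conjecture-strength unit statement; W. Zhang 2014 proves the mod-`p` non-vanishing of SOME derived class
for `p ≥ 5` ordinary, not `p = 3` additive, and for INERT Kolyvagin primes, not split ring-class conductors).
[cite: LiuZhangZhang2018, Thm. 1.5.3 and (1.5)] [cite: Vatsal2003, §1] [cite: WZhang2014, Thm. 1.1] [cite: GrossLMS1991, §3–4] -/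
def TamePinSupplyAtThree : Prop :=
  ∀ (W : WeierstrassCurve ℚ) [W.IsElliptic] [W.IsGloballyMinimal]
    [(W.baseChange ℂ_[3]).IsIntegral (NormedField.valuation (K := ℂ_[3])).integer]
    (N : ℕ) [NeZero N] (K : Type) [Field K] [NumberField K] (Dt : ModularParametrizationData W N)
    (𝔭 : HeightOneSpectrum (𝓞 K)) (ι' : PadicAlgCl 3 ≃+* ℂ),
    Summit.BirchSwinnertonDyer.Rank1Residual.Additive.ClassO6 W 3 → W.HasSurjectiveModNGaloisRep 3 →
    W.analyticRank = 1 → W.conductorNorm ℤ = N →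
    IsImaginaryQuadratic K → SatisfiesHeegnerHypothesis N K →
    ((3 : ℕ) : 𝓞 K) ∈ 𝔭.asIdeal → BranchInducesPrime 3 ι' 𝔭 →
    ∃ (ιK : K →+* ℂ) (ℓ a : ℕ) (β : ℤ) (ν : ringClassGal ιK ℓ →* ℂˣ)
      (y : (W.baseChange (ringClassField K ιK ℓ)).toAffine.Point),
      (∀ k : 𝓞 K, k ∈ 𝔭.asIdeal ↔ ‖ι'.symm (ιK (k : K))‖ < 1) ∧
      ℓ.Prime ∧ ¬ ℓ ∣ 3 * N ∧ ((Ideal.span {(ℓ : ℤ)}).primesOver (𝓞 K)).ncard = 2 ∧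
      0 < a ∧ orderOf ν = 3 ^ a ∧
      4 * (N : ℤ) ∣ β ^ 2 - NumberField.discr K ∧
      WeierstrassCurve.Affine.Point.map (ringClassField K ιK ℓ).subtype.toRatAlgHom y =
        heegnerPointComplexOfConductor Dt (NumberField.discr K) β ℓ ∧
      ‖(3 : ℂ_[3])‖ < ‖heegnerCharLogSum ι' ιK ℓ W ν y‖

/-- **ONE-BLOCK BOUND** (the typed meeting point; UNDECIDED, supplied by the transfer stub from the tame pin): on the torsion locus of
`X_(∅,0)` the residual invariants grow at rate AT MOST `2`: `#(Sel_(∅,0)(K_∞,E[3^∞])[3])^{γ^{3^n}} ≤ 3^{2·3^n + C}` — i.e. `X_(∅,0)(E)`,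
equivalently `X_(∅,0)(E ⊗ ν)` (same residual datum), has at most TWO `μ`-blocks (`μ_π ≤ 2 = v_π((pin_ν)) `).
[cite: GreenbergVatsal2000, §2 Prop. (2.8)] [cite: Hsieh2014, Thm. B] [cite: Washington1997, §13.2] -/
def OneBlockBoundAtThree : Prop :=
  ∀ (W : WeierstrassCurve ℚ) [W.IsElliptic] [W.IsGloballyMinimal] (N : ℕ) [NeZero N]
    (K : Type) [Field K] [NumberField K] (Dt : ModularParametrizationData W N),
    Summit.BirchSwinnertonDyer.Rank1Residual.Additive.ClassO6 W 3 → W.HasSurjectiveModNGaloisRep 3 →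
    W.analyticRank = 1 → W.conductorNorm ℤ = N →
    IsImaginaryQuadratic K → SatisfiesHeegnerHypothesis N K →
    ∀ (κ : ZpExtension K 3), κ.IsAnticyclotomic →
    ∀ (γ : absoluteGaloisGroup K) [Fact (κ.IsTopGenerator γ)]
      (𝔭 : HeightOneSpectrum (𝓞 K)), ((3 : ℕ) : 𝓞 K) ∈ 𝔭.asIdeal →
    ∀ (𝔭' : HeightOneSpectrum (𝓞 K)), ((3 : ℕ) : 𝓞 K) ∈ 𝔭'.asIdeal → 𝔭' ≠ 𝔭 →
    ∀ (ι' : PadicAlgCl 3 ≃+* ℂ), BranchInducesPrime 3 ι' 𝔭 →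
      Module.IsTorsion (IwasawaAlgebra 3) (XAc (W.baseChange K) 3 κ 𝔭' ∅ γ) →
      ∃ C : ℕ, ∀ n : ℕ, (InvSet (W.baseChange K) κ 𝔭' γ n).Finite ∧
        Nat.card (InvSet (W.baseChange K) κ 𝔭' γ n) ≤ 3 ^ (2 * 3 ^ n + C)

/-- **LAST-BLOCK EXCLUSION** (IDEA-NEEDED, the honest residual leaf): on the torsion locus the residual invariants do NOT grow
two-sidedly at rate EXACTLY `2` — `X_(∅,0)` does not have exactly two `μ`-blocks (`s ≠ 2`; by SYMP `s = 2 ⟺ M` has exactly one block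
`⟺ b₀₀ = 1` in the structure count of this node's notes).  It forbids ONE growth rate; it asserts no finiteness.  Known suppliers reach it
only through `s = 0` (24737 twin-μ; FINE of node #25 symplectic-isotropy-cut); a direct supplier is the open question of the node.
[cite: GreenbergVatsal2000, §2 Prop. (2.8)] [cite: Nekovar2006, 10.7.18] [cite: Washington1997, §13.2] -/
def LastBlockExclusionAtThree : Prop :=
  ∀ (W : WeierstrassCurve ℚ) [W.IsElliptic] [W.IsGloballyMinimal] (N : ℕ) [NeZero N]
    (K : Type) [Field K] [NumberField K],
    Summit.BirchSwinnertonDyer.Rank1Residual.Additive.ClassO6 W 3 → W.HasSurjectiveModNGaloisRep 3 →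
    W.analyticRank = 1 → W.conductorNorm ℤ = N →
    IsImaginaryQuadratic K → SatisfiesHeegnerHypothesis N K →
    ∀ (κ : ZpExtension K 3), κ.IsAnticyclotomic →
    ∀ (γ : absoluteGaloisGroup K) [Fact (κ.IsTopGenerator γ)]
      (𝔭' : HeightOneSpectrum (𝓞 K)), ((3 : ℕ) : 𝓞 K) ∈ 𝔭'.asIdeal →
      Module.IsTorsion (IwasawaAlgebra 3) (XAc (W.baseChange K) 3 κ 𝔭' ∅ γ) →
      ¬ ∃ C : ℕ, ∀ n : ℕ, 3 ^ (2 * 3 ^ n) ≤ Nat.card (InvSet (W.baseChange K) κ 𝔭' γ n) * 3 ^ C ∧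
        Nat.card (InvSet (W.baseChange K) κ 𝔭' γ n) ≤ 3 ^ (2 * 3 ^ n + C)

/-! ## §2 Kernel-checked evidence (no `sorry`) -/

/-- Split primes `v ∤ 3` of `K` are finitely decomposed in the anticyclotomic `ℤ₃`-tower (Brink 2007, Thm. 2 — the tree's named fact,
restated here as the DEFECT-FREENESS input of the twist-invariance step of `stub_oneBlock_of_tamePin`: finitely many `w ∣ ℓ` in `K_∞`).
[cite: Brink2007, Thm. 2 (pp. 2134–2135)] -/
theorem splitPrime_finitelyDecomposed_input (K : Type) [Field K] [NumberField K]
    (h : decomp_not_le_kerSubgroup_of_isAnticyclotomic K 3) (hK : IsImaginaryQuadratic K)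
    (κ : ZpExtension K 3) (hκ : κ.IsAnticyclotomic) (v : HeightOneSpectrum (𝓞 K)) (hv : ((3 : ℕ) : 𝓞 K) ∉ v.asIdeal)
    (he : v.asIdeal.ramificationIdx (𝓞 ℚ) = 1) (hf : v.asIdeal.inertiaDeg (𝓞 ℚ) = 1) :
    ¬ (GreenbergSelmer.decomp v ≤ κ.kerSubgroup) :=
  h hK (by norm_num) κ hκ v hv he hf

/-- A growth rate `s` with `s·3^n ≤ 2·3^n + C` for all `n` is at most `2` (the ONE-BLOCK squeeze). [folklore] -/
theorem rate_le_two {s C : ℕ} (h : ∀ n : ℕ, s * 3 ^ n ≤ 2 * 3 ^ n + C) : s ≤ 2 := by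
  by_contra hs
  have hs3 : 3 ≤ s := by omega
  have hC : C < 3 ^ C := Nat.lt_pow_self (by norm_num : 1 < 3)
  have h1 := h C
  have h2 : 3 * 3 ^ C ≤ s * 3 ^ C := Nat.mul_le_mul_right _ hs3
  omega

/-- An even number `≤ 2` and `≠ 2` is `0` — the residual shadow of «SYMP + one-block bound + last-block exclusion force `μ = 0`». [folklore] -/
theorem eq_zero_of_even_of_le_two_of_ne_two {s : ℕ} (he : Even s) (hs : s ≤ 2) (hne : s ≠ 2) : s = 0 := by
  obtain ⟨t, rfl⟩ := he
  omega

/-- **The squeeze to two blocks** (kernel): an upper growth bound of rate `2` (ONE-BLOCK) against a two-sided growth of rate `s` (SYMP)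
forces `s ≤ 2`. [folklore] -/
theorem rate_le_two_of_growth {V : ℕ → ℕ} {s C₁ C₂ : ℕ}
    (hup : ∀ n : ℕ, V n ≤ 3 ^ (2 * 3 ^ n + C₁))
    (hlow : ∀ n : ℕ, 3 ^ (s * 3 ^ n) ≤ V n * 3 ^ C₂) : s ≤ 2 := by
  refine rate_le_two (C := C₁ + C₂) fun n ↦ ?_
  have h : 3 ^ (s * 3 ^ n) ≤ 3 ^ (2 * 3 ^ n + C₁ + C₂) := by
    calc 3 ^ (s * 3 ^ n) ≤ V n * 3 ^ C₂ := hlow n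
      _ ≤ 3 ^ (2 * 3 ^ n + C₁) * 3 ^ C₂ := Nat.mul_le_mul_right _ (hup n)
      _ = 3 ^ (2 * 3 ^ n + C₁ + C₂) := by rw [← pow_add]
  have h' : s * 3 ^ n ≤ 2 * 3 ^ n + C₁ + C₂ := (Nat.pow_le_pow_iff_right (by norm_num)).mp h
  omega

/-- **PIN FLOOR, kernel form** (barrier note B-g30-1 made checkable): a two-sided EVEN rate `s ≤ 2` is `0` or `2` — the tame pin alone
(which gives `s ≤ 2`) cannot decide between them; `LastBlockExclusionAtThree` is exactly the missing bit. [folklore] -/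
theorem even_le_two_dichotomy {s : ℕ} (he : Even s) (hs : s ≤ 2) : s = 0 ∨ s = 2 := by
  obtain ⟨t, rfl⟩ := he
  omega

/-- **The μ-half (datum form) from the pieces** (kernel): ONE-BLOCK + SYMP + LAST-BLOCK EXCLUSION + EXH ⟹ `Sel_(∅,0)(K_∞, E[3^∞])[3]`
finite whenever `X_(∅,0)` is `Λ`-torsion. [cite: GreenbergVatsal2000, §2 Prop. (2.8)] [cite: Washington1997, §13.2] -/
theorem residualFiniteWithDatum_of_pieces :
    OneBlockBoundAtThree → SymplecticGrowthAtThree → LastBlockExclusionAtThree → FiniteOfBoundedInvariantsAtThree →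
      ResidualFiniteOnTorsionLocusWithDatumAtThree := by
  intro hO hS hX hB W _ _ N _ K _ _ Dt hO6 hsurj hr1 hN hK hH κ hκ γ _ 𝔭 h3 𝔭' h3' hne ι' hι hT
  obtain ⟨C₁, h₁⟩ := hO W N K Dt hO6 hsurj hr1 hN hK hH κ hκ γ 𝔭 h3 𝔭' h3' hne ι' hι hT
  obtain ⟨s, C₂, he, h₂⟩ := hS W N K hO6 hsurj hr1 hN hK hH κ hκ γ 𝔭' h3' hT
  have hs2 : s ≤ 2 :=
    rate_le_two_of_growth (V := fun n ↦ Nat.card (InvSet (W.baseChange K) κ 𝔭' γ n))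
      (fun n ↦ (h₁ n).2) (fun n ↦ (h₂ n).2.1)
  have hne2 : s ≠ 2 := by
    intro h2
    subst h2
    exact hX W N K hO6 hsurj hr1 hN hK hH κ hκ γ 𝔭' h3' hT ⟨C₂, fun n ↦ ⟨(h₂ n).2.1, (h₂ n).2.2⟩⟩
  have hs0 : s = 0 := eq_zero_of_even_of_le_two_of_ne_two he hs2 hne2
  subst hs0
  refine hB K (W.baseChange K) κ γ 𝔭' ⟨C₂, fun n ↦ ⟨(h₁ n).1, ?_⟩⟩
  have h := (h₂ n).2.2
  simp only [zero_mul, zero_add] at h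
  exact h

/-- **The wall from RATWALL + the μ-half (datum form)** (kernel; node #25's g17 road with `Dt`, `𝔭`, `ι'` threaded: on the torsion
locus the finite residual Selmer gives a `μ = 0` generator `g` of `Ch_Λ(X_(∅,0))` (`isTorsion_and_exists_generator_of_finite_pTorsion`),
RATWALL gives `g ∣ 3^k·L`, and `3 ∤ g` removes the `3^k`; off it the inclusion is the landed vacuity lemma).
[cite: GreenbergVatsal2000, §2 Prop. (2.8)] [cite: Washington1997, §7.1, §13.2] -/
theorem wall_of_ratwall_of_residualFiniteWithDatum :
    RationalSplitIMCInclusionAtThree → ResidualFiniteOnTorsionLocusWithDatumAtThree → AdditiveSplitIMCInclusionAtThree := by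
  intro hR hF W _ _ N _ K _ _ Dt hO6 hsurj hr1 hN hK hH κ hκ γ _ 𝔭 h3 he hf 𝔭' h3' hne ι' hι ΩK Ωp L hΩK hΩp hL
  by_cases hT : Module.IsTorsion (IwasawaAlgebra 3) (XAc (W.baseChange K) 3 κ 𝔭' ∅ γ)
  · obtain ⟨k, hk⟩ := hR W N K Dt hO6 hsurj hr1 hN hK hH κ hκ γ 𝔭 h3 he hf 𝔭' h3' hne ι' hι ΩK Ωp L hΩK hΩp hL
    have hfin := hF W N K Dt hO6 hsurj hr1 hN hK hH κ hκ γ 𝔭 h3 𝔭' h3' hne ι' hι hT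
    obtain ⟨-, g, hg, i, hi⟩ :=
      isTorsion_and_exists_generator_of_finite_pTorsion (W.baseChange K) 3 κ 𝔭' ∅ γ Set.finite_empty hfin
    rw [hg] at hk ⊢
    have hdvd : g ∣ ((3 : ℕ) : UnrSeries 3) ^ k * L := Ideal.mem_span_singleton.mp hk
    rw [← map_natCast (PowerSeries.C (R := unrIntegers 3))] at hdvd
    exact Ideal.span_singleton_le_span_singleton.mpr
      (dvd_of_dvd_prime_pow_mul prime_C_three (not_C_three_dvd_of_norm_coeff_eq_one hi) k hdvd)
  · exact span_le_map_charIdeal_of_not_isTorsion hT _ L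

/-- Shape witness: `LastBlockExclusionAtThree`'s matrix is consistent with BOUNDED invariants (it forbids rate `2`, not rate `0`) — a
constant sequence violates the rate-`2` lower bound, so the leaf does not secretly assert non-finiteness or restate the μ-half. [folklore] -/
theorem lastBlock_shape_example (C : ℕ) : ¬ ∀ n : ℕ, 3 ^ (2 * 3 ^ n) ≤ 1 * 3 ^ C := by
  intro h
  have h1 := h C
  have hC : C < 3 ^ C := Nat.lt_pow_self (by norm_num : 1 < 3)
  have h2 : 3 ^ C < 3 ^ (2 * 3 ^ C) := Nat.pow_lt_pow_right (by norm_num) (by omega)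
  omega

/-! ## §3 The six stubs of the node (the ONLY `sorry`s of this file) -/

/-- RATWALL (route crux 24207, WEAKER than the wall; LEAD line `ratwall_thin_comb`). -/
theorem stub_ratwall : RationalSplitIMCInclusionAtThree := by
  sorry

/-- TAME PIN SUPPLY — a split-conductor `3`-power-order ring-class twist whose isotypic Heegner logarithm has the Kolyvagin-derivative
valuation (INSTRUMENTABLE, print-adjacent; F-g30-a). -/
theorem stub_tamePinSupply : TamePinSupplyAtThree := by
  sorry

/-- TRANSFER — tame pin ⟹ one-block bound: GV residual twist-invariance of `s` (defect-free at split `ℓ`, Brink) + the LEAD comb on the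
`ν`-line with Hsieh's `μ(ℒ_ν) = 0` at any level + LZZ Thm. 1.5.3 reading the pin as `(heegnerCharLogSum)²` (UNDECIDED, L; carries the
integrality instance of the minimal model over `𝒪_{ℂ₃}`). -/
theorem stub_oneBlock_of_tamePin : TamePinSupplyAtThree → OneBlockBoundAtThree := by
  sorry

/-- SYMP — Nekovář's symplectic structure for the conjugate pair: `s` even, two-sided growth (verbatim node `symplectic_isotropy_cut`). -/
theorem stub_symplecticGrowth : SymplecticGrowthAtThree := by
  sorry

/-- LAST-BLOCK EXCLUSION — `s ≠ 2` (IDEA-NEEDED; the honest residual leaf of the tame-pin road). -/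
theorem stub_lastBlockExclusion : LastBlockExclusionAtThree := by
  sorry

/-- EXH — discrete `Γ`-module exhaustion (ATTACKABLE, S; shared with node `symplectic_isotropy_cut`). -/
theorem stub_finiteOfBoundedInvariants : FiniteOfBoundedInvariantsAtThree := by
  sorry

/-! ## §4 TOP composition: the crux BY NAME -/

/-- **The wall from RATWALL + TAME PIN + TRANSFER + SYMP + LAST-BLOCK EXCLUSION + EXH.**  Concludes `AdditiveSplitIMCInclusionAtThree`
BY NAME. [cite: GreenbergVatsal2000, §2 Prop. (2.8)] [cite: LiuZhangZhang2018, Thm. 1.5.3] [cite: Washington1997, §13.2] -/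
theorem AdditiveSplitIMCInclusionAtThree_of :
    RationalSplitIMCInclusionAtThree → TamePinSupplyAtThree → (TamePinSupplyAtThree → OneBlockBoundAtThree) →
      SymplecticGrowthAtThree → LastBlockExclusionAtThree → FiniteOfBoundedInvariantsAtThree →
        AdditiveSplitIMCInclusionAtThree :=
  fun hR hP hT hS hX hB ↦
    wall_of_ratwall_of_residualFiniteWithDatum hR (residualFiniteWithDatum_of_pieces (hT hP) hS hX hB)

/-- The top composition run on the stubs: the crux BY NAME (sorries only through `stub_*`). -/
theorem AdditiveSplitIMCInclusionAtThree_holds_of_stubs : AdditiveSplitIMCInclusionAtThree :=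
  AdditiveSplitIMCInclusionAtThree_of stub_ratwall stub_tamePinSupply stub_oneBlock_of_tamePin stub_symplecticGrowth
    stub_lastBlockExclusion stub_finiteOfBoundedInvariants

end Summit.BirchSwinnertonDyer.BirchSwinnertonDyer.Cruxes.AdditiveSplitIMCInclusionAtThree.TamePinTranslation

end
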